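import Literature.AlgebraicGeometry.Frobenioids.NumberFieldLocalizationApplication
import Literature.AlgebraicGeometry.Frobenioids.NumberFieldLocalizationCategoriesProofs
import Literature.AlgebraicGeometry.Frobenioids.BCatOrbits
import Literature.AlgebraicGeometry.Frobenioids.CategoriesFactorization
import Mathlib.CategoryTheory.Adjunction.Limits
import HarnessLib

/-!
# Frobenioids II, Example 1.4 (iii) — FACT-LIST F-0719 `NFLocCat.ApplicationToPadicFrobenioids`: the
# direct-head instances of the printed (unrepaired) typing — it HOLDS at `D_v = Gal(F̃/F)` (proof-only)

Mochizuki, *The geometry of Frobenioids II: poly-Frobenioids*, Kyushu J. Math. **62** (2008) 401–460, §1,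
Example 1.4 (iii) p. 13 [cite: MochizukiFrdII2008, Ex. 1.4 (iii) p.13]: "given a connected, totally
epimorphic category `P` and a functor `P → P₀`, one obtains a connected, totally epimorphic category
`E := P ×_{P₀} E₀` [cf. Prop. 1.5 (ii), (iii)] … If, moreover, `P` is of FSM-type, then `E` is of
FSMFF-type [cf. Prop. 1.5 (viii)] … if `P` is … slim, then so is `E` [cf. Prop. 1.5 (iv)]; if `P` is of
strongly indissectible type, then so is `E` [cf. Prop. 1.5 (vii)]."

PROOF-ONLY companion (abc-iut cell, block F, KEY row INST59D, seat abc-iut-f-055; 0 `def` / `structure`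
/ `instance`, no `Prop` fact) of abc-iut-L1-t8's `NumberFieldLocalizationCategories.lean`, FACT-LIST row
**F-0719**, the AS-PRINTED typing `NFLocCat.ApplicationToPadicFrobenioids G D` (all five clauses, for an
ARBITRARY topological group `G` and subgroup `D = D_v`).  State of the row in the tree: REFUTED as typed
(abc-iut-L1's W-12 witness `not_applicationToPadicFrobenioids_klein_four` at
`(G, D) = (Gal(ℚ(√2,√3)/ℚ), D_{23}) ≅ (V₄, 1)`: the fifth clause fails in the degenerate case of
Prop. 1.5 (vii); and `exists_profinite_not_applicationToPadicFrobenioids`), the REPAIRED form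
`ApplicationToPadicFrobenioidsRepaired` PROVED (abc-iut-L1-d4, `applicationToPadicFrobenioidsRepaired_holds`);
the L-F kernel census (plan/LF-KERNEL-STATUS.tsv, 2026-08-27, col 14: «closure REFUTERS 2») found NO
theorem whose conclusion head is the frozen `ApplicationToPadicFrobenioids`.

THIS FILE: the as-printed row DOES hold at a natural arithmetic instance — `D_v = G` (PROFINITE), i.e. a
valuation `v` with a UNIQUE prime of `F̃` above it (e.g. `v` totally ramified or inert in every finite
layer of `F̃/F`): `applicationToPadicFrobenioids_top`.  Mechanism (all elementary, over abc-iut-L1-d9/d4's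
Ex. 1.4 (ii) facts): for `D = G` the structure arrow `ι : P ↪ ρ(Q)` of an object of `E₀` is a
monomorphism between single orbits, hence an ISOMORPHISM, so `E₀ → P₀` is FULL (`toP₀_full_top`; faithful
and essentially surjective by d9/d4), i.e. an EQUIVALENCE (`toP₀_isEquivalence_top`); then
`E = P ×_{P₀} E₀ → P` is an equivalence ([FrdI] §0, abc-iut-L1's `CFP.isEquivalence_proj₁`), so an object of
`E` is non-initial iff its projection is (`isNonemptyObj_iff_fst_top`) — which is exactly the
non-degeneracy hypothesis `hne` of the repaired Prop. 1.5 (vii) — and abc-iut-L1-d4's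
`application_of_profinite` + `isOfStronglyIndissectibleType_of_fst` give all five printed clauses.
Also recorded, for every `D`: the CONDITIONAL direct-head form `applicationToPadicFrobenioids_of_hne`
(profinite `G` + `hne` for every `P → P₀` ⇒ the as-printed row), of which the `D = G` instance is the
unconditional specialisation.  HONEST LABEL: the as-printed row remains FALSE in general (`D_v = 1`,
W-12); the instance here is the opposite extreme `D_v = G`; no new reading of print is proposed and the
repaired statement is the one the cell consumes.  [FrdII] is refereed, undisputed mathematics; nothing
here is specific to the abc programme or bears on [IUTchIII] Cor. 3.12.
-/

namespace Literature.AlgebraicGeometry.Frobenioids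

namespace NFLocCat

open CategoryTheory CategoryTheory.Limits

universe v' u' u

variable {G : Type u} [Group G] [TopologicalSpace G] [IsTopologicalGroup G]

/-- **For `D_v = G`, `E₀ → P₀` is FULL.**  The structure arrow `ι : P ↪ ρ(Q) = Q|_G` of an object
`(P, Q, ι)` of `E₀` is a monomorphism from a connected object onto a single `G`-orbit, hence bijective,
hence an isomorphism of `B(G)`-objects restricted to `⊤`; so every `P → P'` extends (uniquely) to a
morphism of triples, the `Q`-component being `ι' ∘ (P → P') ∘ ι⁻¹` read as a `G`-map.
[cite: MochizukiFrdII2008, Ex. 1.4 (ii) p.13] -/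
theorem toP₀_full_top : (toP₀ G (⊤ : Subgroup G)).Full where
  map_surjective {T T'} h := by
    obtain ⟨x⟩ := nonempty_left (⊤ : Subgroup G) T
    -- `Q|_⊤` is a single `⊤`-orbit, for every connected `Q`
    have hresQ : ∀ R : QCat G, IsConnectedObj ((rho G (⊤ : Subgroup G)).obj R) := fun R => by
      obtain ⟨r₀⟩ := BCat.nonempty_of_isNonemptyObj _ R.property.1
      refine BCat.isConnectedObj_of_transitive _ r₀ fun r => ?_
      obtain ⟨g, hg⟩ := BCat.exists_smul_eq_of_isConnectedObj _ R.property r₀ r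
      exact ⟨⟨g, Subgroup.mem_top g⟩, hg⟩
    -- the structure arrow of `T` is an isomorphism
    have hbij : Function.Bijective T.obj.hom.hom.hom :=
      ⟨hom_injective (⊤ : Subgroup G) T,
        BCat.surjective_of_isConnectedObj T.obj.hom x (hresQ T.obj.right)⟩
    haveI : IsIso T.obj.hom := BCat.isIso_of_bijective _ hbij
    have he : ∀ p, (inv T.obj.hom).hom.hom (T.obj.hom.hom.hom p) = p := fun p => by
      have := congrArg (fun k => k.hom.hom p) (IsIso.hom_inv_id T.obj.hom)
      exact this
    -- the `Q`-component, first as a `⊤`-map `Q|_⊤ → Q'|_⊤`, then as a `G`-map `Q → Q'`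
    let f₀ : (rho G (⊤ : Subgroup G)).obj T.obj.right ⟶ (rho G (⊤ : Subgroup G)).obj T'.obj.right :=
      inv T.obj.hom ≫ h.hom ≫ T'.obj.hom
    let q₀ : T.obj.right.obj ⟶ T'.obj.right.obj := ObjectProperty.homMk
      { hom := f₀.hom.hom
        comm := fun g => f₀.hom.comm ⟨g, Subgroup.mem_top g⟩ }
    refine ⟨ObjectProperty.homMk
      { left := h
        right := ObjectProperty.homMk q₀
        w := BCat.hom_ext_apply fun p => ?_ }, rfl⟩
    change T'.obj.hom.hom.hom (h.hom.hom.hom p) =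
      T'.obj.hom.hom.hom (h.hom.hom.hom ((inv T.obj.hom).hom.hom (T.obj.hom.hom.hom p)))
    rw [he]

/-- **For `D_v = G` PROFINITE, `E₀ → P₀` is an EQUIVALENCE of categories** (full: `toP₀_full_top`;
faithful: abc-iut-L1-d9's `toP₀Faithful_holds`; essentially surjective: abc-iut-L1-d4's
`toP₀EssSurj_of_profinite`). [cite: MochizukiFrdII2008, Ex. 1.4 (ii) p.13] -/
theorem toP₀_isEquivalence_top [CompactSpace G] [TotallyDisconnectedSpace G] :
    (toP₀ G (⊤ : Subgroup G)).IsEquivalence :=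
  haveI : (toP₀ G (⊤ : Subgroup G)).Full := toP₀_full_top
  haveI : (toP₀ G (⊤ : Subgroup G)).Faithful := toP₀Faithful_holds ⊤
  haveI : (toP₀ G (⊤ : Subgroup G)).EssSurj := toP₀EssSurj_of_profinite G ⊤
  { }

/-- **For `D_v = G` PROFINITE, an object of `E = P ×_{P₀} E₀` is non-initial iff its projection to `P`
is** — the non-degeneracy hypothesis `hne` of the repaired [FrdII] Prop. 1.5 (vii) holds automatically:
`E → P` is an equivalence ([FrdI] §0: the projection of a categorical fiber product along an equivalence,
`CFP.isEquivalence_proj₁`), and equivalences preserve and reflect initial objects.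
[cite: MochizukiFrdII2008, Prop. 1.5 (vii) p.14] -/
theorem isNonemptyObj_iff_fst_top [CompactSpace G] [TotallyDisconnectedSpace G]
    {P : Type u'} [Category.{v'} P] (Φ : P ⥤ PCat G (⊤ : Subgroup G))
    (Y : CFP Φ (toP₀ G (⊤ : Subgroup G))) :
    IsNonemptyObj Y ↔ IsNonemptyObj Y.fst := by
  haveI := toP₀_isEquivalence_top (G := G)
  haveI : (CFP.proj₁ Φ (toP₀ G (⊤ : Subgroup G))).IsEquivalence := CFP.isEquivalence_proj₁ Φ _
  constructor
  · intro hY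
    exact ⟨fun h => hY.false (IsInitial.isInitialOfObj (CFP.proj₁ Φ (toP₀ G (⊤ : Subgroup G))) Y h)⟩
  · intro hY
    exact ⟨fun h => hY.false (IsInitial.isInitialObj (CFP.proj₁ Φ (toP₀ G (⊤ : Subgroup G))) Y h)⟩

/-- **CONDITIONAL direct-head form (every `D_v`)**: for PROFINITE `G`, if for every functor `P → P₀`
the objects of `E = P ×_{P₀} E₀` are non-initial exactly when their projections are (the `hne` of the
repaired Prop. 1.5 (vii)), then the AS-PRINTED `ApplicationToPadicFrobenioids G D` holds — abc-iut-L1-d4's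
`application_of_profinite` (clauses 1–4) and `isOfStronglyIndissectibleType_of_fst` (clause 5).
[cite: MochizukiFrdII2008, Ex. 1.4 (iii) p.13] -/
theorem applicationToPadicFrobenioids_of_hne [CompactSpace G] [TotallyDisconnectedSpace G]
    (D : Subgroup G)
    (hne : ∀ {P : Type u'} [Category.{v'} P] (Φ : P ⥤ PCat G D) (Y : CFP Φ (toP₀ G D)),
      IsNonemptyObj Y ↔ IsNonemptyObj Y.fst) :
    Literature.AlgebraicGeometry.Frobenioids.NFLocCat.ApplicationToPadicFrobenioids.{v', u', u} G D := by
  intro D₀ _ _ P _ Φ hPc hPt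
  obtain ⟨h1, h2, h3, h4⟩ := application_of_profinite D Φ hPc hPt
  exact ⟨h1, h2, h3, h4, isOfStronglyIndissectibleType_of_fst D Φ (fun Y => hne Φ Y)⟩

/-- **[FrdII] Example 1.4 (iii) AS PRINTED holds at `D_v = G` PROFINITE** (a valuation with a unique
prime of `F̃` above it): for every connected, totally epimorphic `P` with a functor `P → P₀` (and any
`P₀ → D₀`), `E = P ×_{P₀} E₀` is connected and totally epimorphic, of FSMFF-type if `P` is of FSM-type,
slim if `P` is slim, AND of strongly indissectible type if `P` is — the last clause because the
degenerate case of Prop. 1.5 (vii) cannot occur when `E → P` is an equivalence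
(`isNonemptyObj_iff_fst_top`).  Conclusion head = the frozen `NFLocCat.ApplicationToPadicFrobenioids`
(FACT-LIST F-0719), the instance the W-12 refuter (`D_v = 1`) spares.
[cite: MochizukiFrdII2008, Ex. 1.4 (iii) p.13] -/
theorem applicationToPadicFrobenioids_top [CompactSpace G] [TotallyDisconnectedSpace G] :
    Literature.AlgebraicGeometry.Frobenioids.NFLocCat.ApplicationToPadicFrobenioids.{v', u', u} G
      (⊤ : Subgroup G) :=
  applicationToPadicFrobenioids_of_hne ⊤ fun Φ Y => isNonemptyObj_iff_fst_top Φ Y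

end NFLocCat

end Literature.AlgebraicGeometry.Frobenioids
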